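import Summits.Ventures.PercRepro.Night2FatXUnloaded

/-!
# night-2: the (2,1) cell of h21 with a fat closure and no three collinear points

A loaded target contains a rank-`2` set of at least three points (`loaded_target_structure`), so when no three
points of `V = G ∖ K` are collinear the `dshGT2` load vanishes everywhere (`dload_gt2_eq_zero_of_no_triangle`);
with a fat closure every lossy basis pair has the fat split and `basis_pair_fair_fat_of_unloaded` gives its fair
share, so the local Hall inequality of the cell holds (`localShadowHall_fat_of_no_triangle`) — the first closed
sub-case of h21's cell beyond the residues of `shadowHall_seven_five_of_residuesZ5`.  Paper
`proofs/NIGHT-2-g32.md` §3.6.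
-/

namespace PercRepro.Shadow

open PercRepro.ThmH PercRepro.PerFlat

variable {α : Type*} [DecidableEq α] {M : Matroid α} [M.Finite] {G : Finset α}

/-- **No load without a triangle**: if no rank-`2` subset of `G ∖ K` has three points, `dload = 0` at every `T ⊆ G`. -/
theorem dload_gt2_eq_zero_of_no_triangle (hG : G ∈ flatsQ M (5 + 1)) (hd : (gr M \ G).card = 2)
    (hk : kColoops M G = 1) (hs : ∀ e ∈ gr M, ∀ f ∈ gr M, e ≠ f → rkN M {e, f} = 2)
    (hl : ∀ e ∈ gr M, M.Indep {e}) (htri : ∀ R ⊆ G \ coloops M G, rkN M R = 2 → R.card ≤ 2)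
    {T : Finset α} (hTG : T ⊆ G) : dload M 5 G (bigP M G) (dshGT2 M 5 G) T = 0 := by
  by_contra hne
  obtain ⟨R, hR, hr2, h3, -⟩ := loaded_target_structure hG hd hk hs hl hTG hne
  have := htri R (hR.trans (Finset.sdiff_subset_sdiff hTG (Finset.Subset.refl _))) hr2
  omega

/-- **The (2,1) cell of h21 with a fat closure and no three collinear points off `K`**: the local Hall inequality. -/
theorem localShadowHall_fat_of_no_triangle (hG : G ∈ flatsQ M (5 + 1)) (hd : (gr M \ G).card = 2)
    (hk : kColoops M G = 1) (hs : ∀ e ∈ gr M, ∀ f ∈ gr M, e ≠ f → rkN M {e, f} = 2)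
    (hl : ∀ e ∈ gr M, M.Indep {e}) (hfat : (fatClosures M 5 G 2).card ≤ 1)
    {B₀ : Finset α} (hB₀ : B₀ ∈ thinMembers M 5 G) (hm₀ : (G \ clF M B₀).card = 2)
    (htri : ∀ R ⊆ G \ coloops M G, rkN M R = 2 → R.card ≤ 2) : LocalShadowHall M 5 G := by
  apply localShadowHall_of_gt2_of_basis_fair hG hd hk hs hl hfat
  intro B hB hnP z hz
  by_cases hl0 : loss M 5 G B z = 0
  · rw [hl0]
    have hd' : (gr M \ G).card ≤ 5 := by omega
    have h1 : 0 ≤ rhoL M 5 G B z := by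
      unfold rhoL
      rw [hl0]
      simp
    have h2 : 0 ≤ lossIncomeH M 5 G (bigP M G) (dshGT2 M 5 G) B z :=
      lossIncomeH_nonneg hG hd' (column_side_gt2 hG hd hk hs hl hfat) B z
    positivity
  · obtain ⟨w₀, x, hD, hne, hw₀, hx⟩ := exists_fat_split hG hd hk hB₀ hm₀ hB hz hl0
    exact basis_pair_fair_fat_of_unloaded hG hd hk hs hl hfat hB₀ hD hne hB hnP hz hl0 hw₀ hx
      (fun T hT _ => dload_gt2_eq_zero_of_no_triangle hG hd hk hs hl htri
        (subset_G_of_mem_shadowAt (mem_tgtSets.1 hT).1))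

end PercRepro.Shadow
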